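import Literature.NumberTheory.EllipticCurves.Kobayashi2003.SignedColemanKatoZeta
import Literature.NumberTheory.EllipticCurves.Kobayashi2003.SignedSelmerTorsion
import Literature.NumberTheory.EllipticCurves.Kobayashi2003.SignedSelmerGeneratorChangeProofs
import Literature.NumberTheory.EllipticCurves.Kobayashi2003.SignedSelmerDualExistsProofs
import Literature.NumberTheory.EllipticCurves.Kato2004.IwasawaH1RankLowerBoundProofs
import Literature.NumberTheory.EllipticCurves.Kato2004.IwasawaCohomologyExistsProofs
import Literature.NumberTheory.EllipticCurves.KatoFineSelmerDualTorsion
import Literature.NumberTheory.EllipticCurves.KatoFineSelmerDualProofs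
import Literature.NumberTheory.EllipticCurves.KatoRankBoundProofs
import Literature.NumberTheory.EllipticCurves.TateModuleFreeProofs
import Literature.NumberTheory.EllipticCurves.TateModuleContinuityProofs
import Literature.NumberTheory.EllipticCurves.LeadingTermPPartProofs
import Literature.NumberTheory.Automorphic.ShimuraCurveRibetTakahashiOptimalModularityProofs
import Literature.NumberTheory.DiophantineGeometry.Conductor
import HarnessLib

/-!
# Kobayashi 2003, Thm. 1.2 (`X^±(E/ℚ_∞)` is finitely generated `Λ`-torsion) DERIVED in the kernel from
# the `η = 1` Coleman/Kato package (Thm. 6.2/6.3/7.3 i) (7.21)), Kato's (12.2.2) (`𝐇¹_Γ ≠ 0`), Kato's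
# Thm. 12.4 (1) ∘ (17.13.1) (`X₀` torsion) and modularity — proofs only

`Proofs` file (theorems only; no definition, no named fact, no instance, no notation) in the cluster
`Kobayashi2003`. Cell `bsd-potss` (HOME `run/shared/lean/pub/bsd-potss/`), seat `bsd-potss-k8q-c2x` g3
(prover; WIDTH-LEVER second lane of item stmt-BirchSwinnertonDyer-19241 `PlusKatoDivisibilityBranch`,
rung K8-Gss2, route `QuadraticBranchSignedControl`: "signed Coleman maps giving Kato divisibility in the
plus theory by name"). HONEST FRAMING: the programme assembles BSD for analytic rank `≤ 1` strictly from
published theorems and types the remainder; BSD is not proved by any of this; the theorem below is an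
IMPLICATION BETWEEN NAMED FACTS (a conditional discharge of `thm12_signedSelmerDual_finite_torsion`),
nothing is booked and no item closes.

## What is proved, and why

The named fact `Kobayashi2003.thm12_signedSelmerDual_finite_torsion` (Kobayashi, Invent. Math. 152,
Thm. 1.2: for `E/ℚ` with good supersingular reduction at the odd prime `p`, `a_p = 0`, the Pontryagin
dual `X^±(E/ℚ_∞)` of `Sel^±(E/ℚ_∞)` is a finitely generated torsion `Λ`-module) is consumed as a
hypothesis by many Summits-side roads (K8 items 19286 / 19608 / `PublishedInputKobThm12Lower`, the K3
small-image files of cell `bsd-ssimc`, …). Kobayashi PROVES it (Thm. 1.2 = Thm. 7.3 ii), p. 13) from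
(7.21) `0 → 𝐇¹(T) → H¹_Iw(T)/H¹_{Iw,±}(T) ≅ Λ → X^±(E/K_∞) → X⁰(E/K_∞) → 0`, whose first arrow is
injective because `𝐇¹(T)` is free of rank one (Kato, Thm. 5.1 iii) = Kato 2004 Thm. 12.4 (2)) and
`Col(z) = L_p ≠ 0` (Thm. 6.3 + Rohrlich), together with Cor. 7.2 (`X⁰` torsion, from Kato Thm. 5.1 i) =
Kato 2004 Thm. 12.4 (1) and Prop. 7.1 ii)). The tree already holds each input as a separate named fact
on PINNED objects:
* `thm62_63_73_signedColemanKato_zeta` (this directory, cell `bsd-ssimc`): the structure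
  `SignedColemanKatoData W p f ϖ κ γ ε I` — an INJECTIVE `col : 𝐇¹_Γ(T_pW) → Λ` and, for every dual
  datum `D` of `Sel^ε(E/ℚ_∞)` and `Y` of `Sel₀(ℚ_∞, E[p^∞])`, some `Λ → D.X → Y.X → 0` making
  `𝐇¹ →ᶜᵒˡ Λ → X^ε → X₀ → 0` exact ((7.21) with (6.13)/(6.14) composed in);
* `Kato2004.one_le_rank_iwasawaH1` (Kato (12.2.2), p. 220): `𝐇¹_Γ(T_pW) ≠ 0`;
* `Kato2004_fineSelmerDual_isTorsion` (Kato Thm. 12.4 (1) ∘ (17.13.1)): `X₀(E/ℚ_∞)` is `Λ`-torsion;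
* `ModularForms.exists_isNewformOf` (modularity: the package is stated on the newform frame).
THIS FILE composes them: §1 the module algebra — along `H →ᶜ R → X → Y` exact with `c` injective,
`H ∋ e ≠ 0` and `Y` torsion, `X` is torsion (`x ↦ (c e · a) • x = 0`); §2 the package form; §3
**`thm12_signedSelmerDual_finite_torsion_of_colemanKato`**: the named fact Thm. 1.2 follows from the
four facts above. Finite generation is the tree THEOREM `SignedSelmerDualData.moduleFinite`; the passage
from the package's normalised pair `(κ₁, γ₁)` (`IsCyclotomicVariable`, tree theorem
`exists_isCyclotomic_isTopGenerator_isCyclotomicVariable_holds`) to an arbitrary cyclotomic pair is the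
tree theorem `SignedSelmerDualData.isTorsion_of_isTorsion_of_isCyclotomic`; the period ratio of the
frame comes from `ModularParametrizationData.exists_rat_mul_realPeriodRat_eq_plusPeriod`.

So every consumer of Thm. 1.2 may now cite, instead of Kobayashi's theorem, the Coleman/Poitou–Tate
CONSTRUCTION package at `η = 1` + two statements of Kato's §12 + modularity — Kobayashi's own proof
structure, kernel-checked. Nothing here is stronger than print; no `_holds` of any of the four inputs
is claimed (Coleman maps, Kato's Euler system, Poitou–Tate along the tower: none in Mathlib).

References: [Kobayashi2003] S. Kobayashi, *Iwasawa theory for elliptic curves at supersingular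
primes*, Invent. Math. 152 (2003), Thm. 1.2 (p. 2), Thm. 5.1 (p. 9), Thm. 6.2–6.3 (p. 11), Prop. 7.1,
Cor. 7.2, Thm. 7.3 i)–ii) and (7.21) (pp. 12–13); [Kato2004Asterisque] K. Kato, Astérisque 295 (2004),
§12.2 (12.2.2) (p. 220), Thm. 12.4 (p. 221), Thm. 12.6 (p. 222), (17.13.1) (p. 279);
[GreenbergLNM1716] §1 p. 60 (the `Λ`-structure is independent of the generator); [Washington1997]
§13.1–13.2.
-/

noncomputable section

open scoped Classical MatrixGroups ModularForm

open CongruenceSubgroup WeierstrassCurve Field Literature.NumberTheory.EllipticCurves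
  Literature.NumberTheory.EllipticCurves.ModularForms Literature.NumberTheory.GaloisRepresentations
  ZpExtension

namespace Literature.NumberTheory.EllipticCurves.Kobayashi2003

/-! ## §1 Module algebra: torsion along `H →ᶜ R → X → Y` -/

/-- **Torsion propagates along (7.21).** Let `R` be a domain and `H →ᶜ R →ʲ X →ᵏ Y` be `R`-linear with
`c` injective, `j ∘ c = 0`-exact at `R` and exact at `X`. If `H` has a non-zero element `e` and `Y` is
torsion, then `X` is torsion: for `x ∈ X` pick `a ≠ 0` with `a • k x = 0`, so `a • x = j l`, and then
`(c e · a) • x = j (l · c e) = l • j (c e) = 0` with `c e ≠ 0`. (Kobayashi's deduction of Thm. 7.3 ii)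
from (7.21), Thm. 7.3 i) and Cor. 7.2.) [cite: Kobayashi2003, Thm. 7.3 and (7.21) (p. 13)] -/
theorem isTorsion_of_exact_of_injective_of_ne_zero {R : Type*} [CommRing R] [IsDomain R]
    {H X Y : Type*} [AddCommGroup H] [Module R H] [AddCommGroup X] [Module R X] [AddCommGroup Y]
    [Module R Y] (c : H →ₗ[R] R) (j : R →ₗ[R] X) (k : X →ₗ[R] Y) (hc : Function.Injective c)
    (hcj : Function.Exact c j) (hjk : Function.Exact j k) {e : H} (he : e ≠ 0)
    (hY : Module.IsTorsion R Y) : Module.IsTorsion R X := by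
  have hce : c e ≠ 0 := fun h ↦ he (hc (by rw [h, map_zero]))
  have hjce : j (c e) = 0 := (hcj (c e)).mpr ⟨e, rfl⟩
  intro x
  obtain ⟨a, ha⟩ := @hY (k x)
  have hkx : k ((a : R) • x) = 0 := by rw [map_smul, ← Submonoid.smul_def, ha]
  obtain ⟨l, hl⟩ := (hjk ((a : R) • x)).mp hkx
  refine ⟨⟨c e * a, mem_nonZeroDivisors_of_ne_zero
    (mul_ne_zero hce (nonZeroDivisors.ne_zero a.2))⟩, ?_⟩
  rw [Submonoid.smul_def, mul_smul, ← hl, ← map_smul, smul_eq_mul, mul_comm, ← smul_eq_mul,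
    map_smul, hjce, smul_zero]

/-! ## §2 The package form: `X^ε(E/ℚ_∞)` is torsion once `𝐇¹_Γ ≠ 0` and `X₀` is torsion -/

section Package

variable {W : WeierstrassCurve ℚ} [W.IsElliptic] {p : ℕ} [Fact p.Prime]
  [ContinuousSMul ℤ_[p] (W.tateModule p)] [Module.Free ℤ_[p] (W.tateModule p)]
  [Module.Finite ℤ_[p] (W.tateModule p)] {N : ℕ} {f : CuspForm (Gamma0 N) 2} {ϖ : ℚ}
  {κ : ZpExtension ℚ p} {γ : absoluteGaloisGroup ℚ} {ε : ℤˣ} {I : Kato2004.IwasawaH1Data W p κ γ}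

/-- **Kobayashi Thm. 7.3 ii) from the `η = 1` Coleman/Kato package**: given a datum
`K : SignedColemanKatoData W p f ϖ κ γ ε I` (injective `col`, (7.21) for every dual datum), if
`𝐇¹_Γ(T_pW) ≠ 0` and some dual fine Selmer datum `Y` has `X₀ = Y.X` torsion, then EVERY dual datum
`D` of `Sel^ε(E/ℚ_∞)` has `D.X` torsion (§1 applied to `𝐇¹ →ᶜᵒˡ Λ → D.X → Y.X`).
[cite: Kobayashi2003, Thm. 7.3 i)–ii), (7.21) and Cor. 7.2 (p. 13)] -/
theorem SignedColemanKatoData.isTorsion_of_nontrivial (K : SignedColemanKatoData W p f ϖ κ γ ε I)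
    [Nontrivial I.H] (Y : W.FineSelmerDualData κ γ)
    (hY : Module.IsTorsion (IwasawaAlgebra p) Y.X) (D : SignedSelmerDualData W κ γ ε) :
    Module.IsTorsion (IwasawaAlgebra p) D.X := by
  obtain ⟨e, he⟩ := exists_ne (0 : I.H)
  obtain ⟨j, k, hcj, hjk, -⟩ := K.exact D Y
  exact isTorsion_of_exact_of_injective_of_ne_zero K.col j k K.col_injective hcj hjk he hY

end Package

/-! ## §3 The named fact Thm. 1.2 from the four named inputs -/

/-- **Kobayashi 2003 Thm. 1.2 DERIVED**: the named fact `thm12_signedSelmerDual_finite_torsion`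
(`X^ε(E/ℚ_∞)` finitely generated `Λ`-torsion for every good supersingular odd `p` with `a_p = 0`, every
cyclotomic pair `(κ, γ)`, sign `ε` and dual datum) follows from: `hCK` — the `η = 1` Coleman/Kato
package `thm62_63_73_signedColemanKato_zeta` (Thm. 6.2 (6.13)/(6.14) + 6.3 + 7.3 i) (7.21) with Kato's
Thm. 12.6 zeta submodule, on pinned objects); `hH1` — Kato's (12.2.2) `1 ≤ rank_Λ 𝐇¹_Γ(T_pW)`
(`Kato2004.one_le_rank_iwasawaH1`); `hYt` — Kato's Thm. 12.4 (1) ∘ (17.13.1), `X₀(E/ℚ_∞)` torsion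
(`Kato2004_fineSelmerDual_isTorsion`); `hmod` — modularity (`exists_isNewformOf`). Proof: finite
generation is the tree theorem `SignedSelmerDualData.moduleFinite`; for torsion take the normalised
cyclotomic pair `(κ₁, γ₁)` (`exists_isCyclotomic_isTopGenerator_isCyclotomicVariable_holds`), the newform
`f` of `W` (`hmod`) with its period ratio `ϖ` (`ModularParametrizationData.exists_rat_mul_realPeriodRat_eq
_plusPeriod` on `nonempty_modularParametrizationData_of_isNewformOf`), the pinned `𝐇¹_Γ` (non-trivial
by `hH1`) and the package datum (`hCK`); §2 with `hYt` gives torsion at `(κ₁, γ₁)`, and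
`SignedSelmerDualData.isTorsion_of_isTorsion_of_isCyclotomic` moves it to `(κ, γ)`. An implication
between named facts; none of the four inputs is discharged here.
[cite: Kobayashi2003, Thm. 1.2 (p. 2), Thm. 7.3 i)–ii), (7.21), Cor. 7.2 (p. 13), Thm. 6.2–6.3 (p. 11)]
[cite: Kato2004Asterisque, §12.2 (12.2.2) (p. 220), Thm. 12.4 (1)–(2) (p. 221), (17.13.1) (p. 279)]
[cite: GreenbergLNM1716, §1 p. 60] -/
theorem thm12_signedSelmerDual_finite_torsion_of_colemanKato
    (hCK : thm62_63_73_signedColemanKato_zeta) (hH1 : Kato2004.one_le_rank_iwasawaH1)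
    (hYt : Kato2004_fineSelmerDual_isTorsion) (hmod : exists_isNewformOf) :
    thm12_signedSelmerDual_finite_torsion := by
  intro W _ _ p _ hp2 hgood hap κ γ hκ hγ ε D
  refine ⟨D.moduleFinite hγ, ?_⟩
  -- the normalised cyclotomic pair and a dual datum there
  obtain ⟨κ₁, hκ₁, γ₁, hγ₁, hγ₁c⟩ := exists_isCyclotomic_isTopGenerator_isCyclotomicVariable_holds p
  obtain ⟨D₁⟩ := nonempty_signedSelmerDualData W κ₁ ε hγ₁
  suffices hT₁ : Module.IsTorsion (IwasawaAlgebra p) D₁.X from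
    SignedSelmerDualData.isTorsion_of_isTorsion_of_isCyclotomic hκ₁ hκ hγ₁ D₁ D hT₁
  -- the newform of `W` and its period ratio
  haveI : NeZero (W.conductorNorm ℤ) := ⟨(W.conductorNorm_pos_holds).ne'⟩
  obtain ⟨f, hf⟩ := hmod W
  obtain ⟨Dm⟩ := Literature.NumberTheory.Automorphic.nonempty_modularParametrizationData_of_isNewformOf hf
  obtain ⟨ϖ, -, hϖ, -⟩ := Dm.exists_rat_mul_realPeriodRat_eq_plusPeriod
  rw [Dm.isNewformOf.unique hf] at hϖ
  -- pins: `T_pW` structure facts, `𝐇¹_Γ` (non-trivial by (12.2.2)), the package datum, `X₀`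
  haveI : ContinuousSMul ℤ_[p] (W.tateModule p) := TateModule.continuousSMul_padicInt
  haveI : Module.Free ℤ_[p] (W.tateModule p) := W.module_free_tateModule_holds p
  haveI : Module.Finite ℤ_[p] (W.tateModule p) := W.module_finite_tateModule_holds p
  obtain ⟨I⟩ := Kato2004.nonempty_iwasawaH1Data_holds W p κ₁ γ₁ hκ₁ hγ₁
  haveI : Nontrivial I.H := Kato2004.nontrivial_of_one_le_rank_iwasawaH1 hH1 W p κ₁ γ₁ hκ₁ hγ₁ I
  obtain ⟨K⟩ := hCK W p f ϖ κ₁ γ₁ hp2 hgood hap hf hϖ hκ₁ hγ₁ hγ₁c ε I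
  obtain ⟨Y⟩ := W.nonempty_fineSelmerDualData κ₁ hγ₁
  exact K.isTorsion_of_nontrivial Y (hYt W p κ₁ γ₁ hκ₁ hγ₁ Y) D₁

end Literature.NumberTheory.EllipticCurves.Kobayashi2003

end
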